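import Summits.CriticalPhenomena.PercolationContinuityZ3.Theorems.PercNearOneGluingNoHeavyLowerTailSahiCombDomination

/-!
# `NoHeavyLowerTail` (crux stmt-CriticalPhenomena-4575), the comb hierarchy at `k = 4`: INTERSECTION-PRESERVING ENLARGEMENT DECREASES
# `E₄` BY A MULTIPLE OF `E₃` — the domination identity one order up, and the transfer (M⁺-3) ⟹ (M⁺-4)-domination

Support file (cell `prim-l12`, seat P3, gen 2; `--supports stmt-CriticalPhenomena-4575`).  No `sorry`, no named facts, standard axioms.

**The identity** (`sahiE_four_domination`).  For events `U, V, A ⊆ A', B` of a finite cube with `A' ∩ B = A ∩ B` and every `p`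
(`d_X := μ(X ∩ A') − μ(X ∩ A) = μ(X ∩ (A' ∖ A))`):

  `E₄(1_U,1_V,1_A,1_B) = E₄(1_U,1_V,1_{A'},1_B) + (μA' − μA)·E₃(1_U,1_V,1_B) + 2μB·d_{U∩V} + d_U·Cov(V,B) + d_V·Cov(U,B)`.

(Companion of the order-3 identity of `…SahiCombDomination`: there the multiplier of `μA' − μA` is `E₂ = Cov(U,B)`; here it is
`E₃(U,V,B)`.  Enlarging both `A` and `B` with `A' ∩ B' = A ∩ B` is two single-slot steps, since `A' ∩ B = A ∩ B` is automatic.)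
Consequences:
* `combPos_sahiE_four_of_enlarge` — COMB TRANSFER: if `E₃(1_U,1_V,1_B)` is comb-positive (e.g. `(U,V,B)` on one of the proved strata of
  (M⁺-3)) and `E₄(1_U,1_V,1_{A'},1_B)` is comb-positive, then `E₄(1_U,1_V,1_A,1_B)` is comb-positive (`U, V, B` increasing);
* `sahiE_four_ind_ge_of_enlarge` — MEASURE LEVEL: `E₄(μ_p; U,V,A,B) ≥ E₄(μ_p; U,V,A',B)` whenever `E₃(μ_p; U,V,B) ≥ 0` — so, GIVEN Kahn's
  Conjecture 5 (`C₃`), Sahi's `E₄` is monotone decreasing under intersection-preserving enlargement, and the extremal configurations for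
  `C₄` at fixed `U, V` and fixed `A ∩ B` are again the closed pairs.
Exact numerical evidence for the same monotonicity at order 5 (no negative instance among 530 random exact evaluations, HOME
code/gen2/domk.py) suggests the all-`k` form `E_k(F, A, B) ≽ E_k(F, A', B)`; not attempted here.
-/

noncomputable section

open scoped Classical

namespace Summit.CriticalPhenomena.PercolationContinuityZ3.Theorems

namespace SahiCombDomination

open Finset Function
open Literature.Combinatorics.Sahi2008
open Literature.Probability.Percolation.DecisionTree (ind ind_of_mem ind_of_not_mem ind_nonneg)
open SahiComb

variable {ι : Type} [Fintype ι]

/-- **The order-4 domination identity.** [this work] -/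
theorem sahiE_four_domination (p : ι → unitInterval) {U V A B A' : Set (Set ι)} (hK : A' ∩ B = A ∩ B) :
    sahiE (bernoulliWeight p) 4 ![ind U, ind V, ind A, ind B] =
      sahiE (bernoulliWeight p) 4 ![ind U, ind V, ind A', ind B]
      + (ex (bernoulliWeight p) (ind A') - ex (bernoulliWeight p) (ind A)) * sahiE (bernoulliWeight p) 3 ![ind U, ind V, ind B]
      + 2 * ex (bernoulliWeight p) (ind B) *
          (ex (bernoulliWeight p) (ind (U ∩ V ∩ A')) - ex (bernoulliWeight p) (ind (U ∩ V ∩ A)))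
      + (ex (bernoulliWeight p) (ind (U ∩ A')) - ex (bernoulliWeight p) (ind (U ∩ A))) * covFun V B p
      + (ex (bernoulliWeight p) (ind (V ∩ A')) - ex (bernoulliWeight p) (ind (V ∩ A))) * covFun U B p := by
  have hprod : ∀ X Y : Set (Set ι), ind X * ind Y = ind (X ∩ Y) := fun X Y => funext fun ω =>
    SahiCombPrincipalMeet.ind_mul_apply X Y ω
  -- the four moments containing both `A'` and `B` are moments with `A` and `B`
  have h1 : A' ∩ B = A ∩ B := hK
  have h2 : U ∩ A' ∩ B = U ∩ A ∩ B := by rw [Set.inter_assoc, hK, ← Set.inter_assoc]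
  have h3 : V ∩ A' ∩ B = V ∩ A ∩ B := by rw [Set.inter_assoc, hK, ← Set.inter_assoc]
  have h4 : U ∩ V ∩ A' ∩ B = U ∩ V ∩ A ∩ B := by rw [Set.inter_assoc, hK, ← Set.inter_assoc]
  rw [sahiE_four, sahiE_four, sahiE_three]
  simp only [hprod, covFun]
  rw [h1, h2, h3, h4]
  ring

/-- **Comb transfer, order 4.**  For increasing `U, V, B`, events `A ⊆ A'` with `A' ∩ B = A ∩ B`: if `E₃(1_U,1_V,1_B)` and
`E₄(1_U,1_V,1_{A'},1_B)` are comb-positive (multidegrees `3`, `4`), then `E₄(1_U,1_V,1_A,1_B)` is comb-positive at multidegree `4`. [this work] -/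
theorem combPos_sahiE_four_of_enlarge {U V A B A' : Set (Set ι)} (hU : IsUpperSet U) (hV : IsUpperSet V) (hB : IsUpperSet B)
    (hAA' : A ⊆ A') (hK : A' ∩ B = A ∩ B)
    (h3 : CombPos (fun _ : ι => 3) (fun p => sahiE (bernoulliWeight p) 3 ![ind U, ind V, ind B]))
    (h4 : CombPos (fun _ : ι => 4) (fun p => sahiE (bernoulliWeight p) 4 ![ind U, ind V, ind A', ind B])) :
    CombPos (fun _ : ι => 4) (fun p => sahiE (bernoulliWeight p) 4 ![ind U, ind V, ind A, ind B]) := by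
  have d13 : (fun _ : ι => (1 : ℕ)) + (fun _ : ι => 3) = fun _ : ι => 4 := by funext e; simp
  have d11 : (fun _ : ι => (1 : ℕ)) + (fun _ : ι => 1) = fun _ : ι => 2 := by funext e; simp
  have d12 : (fun _ : ι => (1 : ℕ)) + (fun _ : ι => 2) = fun _ : ι => 3 := by funext e; simp
  have d24 : (fun _ : ι => (2 : ℕ)) ≤ (fun _ : ι => 4) := fun e => by norm_num
  have d34 : (fun _ : ι => (3 : ℕ)) ≤ (fun _ : ι => 4) := fun e => by norm_num
  have T1 : CombPos (fun _ : ι => 4)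
      (fun p => (ex (bernoulliWeight p) (ind A') - ex (bernoulliWeight p) (ind A)) *
        sahiE (bernoulliWeight p) 3 ![ind U, ind V, ind B]) :=
    (combPos_ex_sub_of_subset hAA').mul_of_eq h3 d13
  have T2 : CombPos (fun _ : ι => 4)
      (fun p => 2 * ex (bernoulliWeight p) (ind B) *
        (ex (bernoulliWeight p) (ind (U ∩ V ∩ A')) - ex (bernoulliWeight p) (ind (U ∩ V ∩ A)))) := by
    have h := ((combPos_ex_ind B).mul_of_eq
      (combPos_ex_sub_of_subset (Set.inter_subset_inter_right (U ∩ V) hAA')) d11).smul (show (0 : ℝ) ≤ 2 by norm_num)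
    exact (h.mono d24).congr fun p => by ring
  have T3 : CombPos (fun _ : ι => 4)
      (fun p => (ex (bernoulliWeight p) (ind (U ∩ A')) - ex (bernoulliWeight p) (ind (U ∩ A))) * covFun V B p) :=
    ((combPos_ex_sub_of_subset (Set.inter_subset_inter_right U hAA')).mul_of_eq (combPos_covFun V B hV hB) d12).mono d34
  have T4 : CombPos (fun _ : ι => 4)
      (fun p => (ex (bernoulliWeight p) (ind (V ∩ A')) - ex (bernoulliWeight p) (ind (V ∩ A))) * covFun U B p) :=
    ((combPos_ex_sub_of_subset (Set.inter_subset_inter_right V hAA')).mul_of_eq (combPos_covFun U B hU hB) d12).mono d34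
  exact ((((h4.add T1).add T2).add T3).add T4).congr fun p => sahiE_four_domination p hK

/-- **Measure level, order 4**: under every product measure with `E₃(μ_p; U,V,B) ≥ 0` (Kahn's Conjecture 5 for that triple — e.g. any
proved stratum), `E₄(μ_p; U,V,A,B) ≥ E₄(μ_p; U,V,A',B)` for increasing `U, V, B`, `A ⊆ A'`, `A' ∩ B = A ∩ B`. [this work] -/
theorem sahiE_four_ind_ge_of_enlarge (p : ι → unitInterval) {U V A B A' : Set (Set ι)} (hU : IsUpperSet U) (hV : IsUpperSet V)
    (hB : IsUpperSet B) (hAA' : A ⊆ A') (hK : A' ∩ B = A ∩ B) (h3 : 0 ≤ sahiE (bernoulliWeight p) 3 ![ind U, ind V, ind B]) :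
    sahiE (bernoulliWeight p) 4 ![ind U, ind V, ind A', ind B] ≤ sahiE (bernoulliWeight p) 4 ![ind U, ind V, ind A, ind B] := by
  rw [sahiE_four_domination p hK]
  have hdA : 0 ≤ ex (bernoulliWeight p) (ind A') - ex (bernoulliWeight p) (ind A) := (combPos_ex_sub_of_subset hAA').nonneg p
  have hb : 0 ≤ ex (bernoulliWeight p) (ind B) := (combPos_ex_ind B).nonneg p
  have hc1 : 0 ≤ covFun V B p := (combPos_covFun V B hV hB).nonneg p
  have hc2 : 0 ≤ covFun U B p := (combPos_covFun U B hU hB).nonneg p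
  have hd1 : 0 ≤ ex (bernoulliWeight p) (ind (U ∩ V ∩ A')) - ex (bernoulliWeight p) (ind (U ∩ V ∩ A)) :=
    (combPos_ex_sub_of_subset (Set.inter_subset_inter_right (U ∩ V) hAA')).nonneg p
  have hd2 : 0 ≤ ex (bernoulliWeight p) (ind (U ∩ A')) - ex (bernoulliWeight p) (ind (U ∩ A)) :=
    (combPos_ex_sub_of_subset (Set.inter_subset_inter_right U hAA')).nonneg p
  have hd3 : 0 ≤ ex (bernoulliWeight p) (ind (V ∩ A')) - ex (bernoulliWeight p) (ind (V ∩ A)) :=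
    (combPos_ex_sub_of_subset (Set.inter_subset_inter_right V hAA')).nonneg p
  have t1 := mul_nonneg hdA h3
  have t2 := mul_nonneg (mul_nonneg (show (0:ℝ) ≤ 2 by norm_num) hb) hd1
  have t3 := mul_nonneg hd2 hc1
  have t4 := mul_nonneg hd3 hc2
  linarith

end SahiCombDomination

end Summit.CriticalPhenomena.PercolationContinuityZ3.Theorems
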